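import Mathlib
import Summits.ValiantsHypothesis.ValiantsHypothesis.Theorems.FifoMatchingNFPolytopeQueueGridGadgetRigidity
import Summits.ValiantsHypothesis.ValiantsHypothesis.Theorems.FifoMatchingNFPolytopeQueueGridGadgetDesigns
import Summits.ValiantsHypothesis.ValiantsHypothesis.Theorems.FifoMatchingNFPolytopeQueueGridFaceReduction
import HarnessLib

/-!
# Route `FifoMatching`, item `NFPolytopeQuasiPolyXC` (K1, stmt-ValiantsHypothesis-26254), line `queue_grid_face`:
# INPUT (A) `QueueGridFaceProjection` PROVED for general `r`

**Theorem (`queueGridFaceProjection`, the body of the line's `QueueGridFaceProjection` verbatim).**  For every `r ≥ 1`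
and `n ≥ (r+1)(2r+1)` there are finitely many linear equations `cv t ⬝ᵥ x = δ t` and a coordinate map `f` such that the
coordinate restriction `x ↦ x ∘ f` maps `Newt(NN_n) ∩ {equations}` EXACTLY onto the pair-pattern polytope
`queueGridPP r = conv{patternVec r X}` of the `r × r` queue grid.  The line file
`Cruxes/NNLinearDegreeCofactorHard/Lines/queue_grid_face.lean` closes its input (A) by `exact queueGridFaceProjection`
(the Theorems-side `QueueGridFace.realOf/suppPts/newt/QGV/qgEdge/patternVec/queueGridPP` of c1 g5's `…QueueGridFaceDefs.lean`
used here are verbatim copies of the line's terms).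

Proof = c1 g5's face-projection reduction `QueueGridFace.face_projection_of_gadget_prop` (p612281: face of a `0/1`-hull
under valid equalities + `LinearMap.image_convexHull`) fed with the layout-B gadget of this seat
(`…QueueGridGadget{Defs,Positions,Counts,Designs,Windows,Rigidity}.lean`): designs `design d X` (h1 nest-free perfect
matchings: the FIFO pairing of a balanced ballot word), supported on the allowed arcs `allowed r d` (h2), RIGIDITY
(h3, `exists_design_eq`: every nest-free perfect matching supported on the allowed arcs is a design — the per-window
feeding lemma + induction on the stretch + c1 g5's opener-set uniqueness p612984), and the read-out (h4,
`coordMap_arc_iff`: the pattern coordinate `((u,v),(a,b))` of an interaction pair is an arc of the design of `X` iff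
`(X u, X v) = (a, b)`).

Honest framing: this is input (A) only.  K1 `NFPolytopeQuasiPolyXC` (stmt-26254) follows from (A) and input (B)
(`QueueGridPPHard`: Avis–Tiwary 2015 + Robertson–Seymour–Thomas 1994, or the B♯ chain Aboulker–Fiorini–Huynh–Macchia–Seif
2019 Thm 6 — print facts being typed in the val-lit lane) by the line's kernel-checked `nfp_xc_of_queueGrid`; until then
K1, HD-1 `NNMonomialCofactorHard`, `NNDivisionHard` and `NNNotVP` stay OPEN, and VP ≠ VNP is NOT proved by anything here
(monotone / polyhedral world).
-/

noncomputable section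

-- Sub = Summit single-conjunct layout: the duplicated namespace component is mandated by the tree.
set_option linter.dupNamespace false

namespace Summit.ValiantsHypothesis.ValiantsHypothesis.Theorems.FifoMatching.NFPolytopeQuasiPolyXC.QueueGridFace

open Finset Matrix MvPolynomial Literature.Computability.AlgebraicComplexity
open Summit.ValiantsHypothesis.ValiantsHypothesis.Theorems.FifoMatching.QueueGridFace
  (realOf suppPts newt QGV qgEdge patternVec queueGridPP face_projection_of_gadget_prop)
open scoped NNReal

variable {r d : ℕ}

/-- the second-pop slot determines the bit -/
theorem QPos.dSlot₂_inj {b b' : Bool} : QPos.dSlot₂ b = QPos.dSlot₂ b' ↔ b = b' := by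
  cases b <;> cases b' <;> decide

/-- the first-pop slot determines the bit -/
theorem QPos.dSlot₁_inj {b b' : Bool} : QPos.dSlot₁ b = QPos.dSlot₁ b' ↔ b = b' := by
  cases b <;> cases b' <;> decide

/-- a first-push slot of bit `a` is a push of the design of `X` iff `X` has bit `a` there -/
theorem QPos.isU_slot_uSlot₁ (X : Fin r × Fin r → Bool) (s i : Fin r) (a : Bool) :
    QPos.isU X (QPos.slot s i (QPos.uSlot₁ a) : QPos r d) = true ↔ X (s, i) = a := by
  cases a <;> cases h : X (s, i) <;> simp [QPos.isU, QPos.uSlot₁, h]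

/-- a second-push slot of bit `a` is a push of the design of `X` iff `X` has bit `a` there -/
theorem QPos.isU_slot_uSlot₂ (X : Fin r × Fin r → Bool) (s i : Fin r) (a : Bool) :
    QPos.isU X (QPos.slot s i (QPos.uSlot₂ a) : QPos r d) = true ↔ X (s, i) = a := by
  cases a <;> cases h : X (s, i) <;> simp [QPos.isU, QPos.uSlot₂, h]

/-- a design has no fixed point -/
theorem design_ne (X : Fin r × Fin r → Bool) (p : Fin (2 * half r d)) : design d X p ≠ p :=
  (mem_perfectMatchings.1 (nestFreeMatchings_subset_perfectMatchings (design_mem_nestFreeMatchings X))).2 p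

/-- **READ-OUT (h4).**  The coordinate `coordMap r d q`, `q = ((u,v),(a,b))`, is an arc of the design of `X` iff `uv` is
an interaction pair of the queue grid and `(X u, X v) = (a, b)`. -/
theorem coordMap_arc_iff (X : Fin r × Fin r → Bool) (q : (QGV r × QGV r) × Bool × Bool) :
    ((coordMap r d q).1 < design d X (coordMap r d q).1 ∧ design d X (coordMap r d q).1 = (coordMap r d q).2) ↔
      (qgEdge r q.1 = true ∧ X q.1.1 = q.2.1 ∧ X q.1.2 = q.2.2) := by
  obtain ⟨⟨u, ⟨v1, v2⟩⟩, a, b⟩ := q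
  unfold coordMap
  split_ifs with hv hd
  · -- vertical pair `(s,i) → (s+1,i)`: first push ↦ second pop
    obtain ⟨hv1, hv2⟩ := hv
    have h : u.1.val + 1 < r := by have := v1.isLt; simp only at hv1; omega
    have e1 : v1 = ⟨u.1.val + 1, h⟩ := Fin.ext hv1
    have e2 : v2 = u.2 := Fin.ext hv2
    subst e1 e2
    have hedge : qgEdge r (u, (⟨u.1.val + 1, h⟩, u.2)) = true := by simp [qgEdge]
    simp only [hedge, true_and, toFin_lt_design_iff, QPos.isU_slot_uSlot₁]
    constructor
    · rintro ⟨ha, hab⟩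
      subst ha
      rw [design_uSlot₁ X u.1 u.2 h, QPos.toFin_inj, QPos.slot.injEq] at hab
      exact ⟨rfl, QPos.dSlot₂_inj.1 hab.2.2⟩
    · rintro ⟨ha, hb⟩
      subst ha hb
      exact ⟨rfl, by rw [design_uSlot₁ X u.1 u.2 h]⟩
  · -- diagonal pair `(s,i) → (s+1,i+1)`: second push ↦ first pop
    obtain ⟨hd1, hd2⟩ := hd
    have h : u.1.val + 1 < r := by have := v1.isLt; simp only at hd1; omega
    have h₂ : u.2.val + 1 < r := by have := v2.isLt; simp only at hd2; omega
    have e1 : v1 = ⟨u.1.val + 1, h⟩ := Fin.ext hd1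
    have e2 : v2 = ⟨u.2.val + 1, h₂⟩ := Fin.ext hd2
    subst e1 e2
    have hedge : qgEdge r (u, (⟨u.1.val + 1, h⟩, ⟨u.2.val + 1, h₂⟩)) = true := by simp [qgEdge]
    simp only [hedge, true_and, toFin_lt_design_iff, QPos.isU_slot_uSlot₂]
    constructor
    · rintro ⟨ha, hab⟩
      subst ha
      rw [design_uSlot₂ X u.1 u.2 h h₂, QPos.toFin_inj, QPos.slot.injEq] at hab
      exact ⟨rfl, QPos.dSlot₁_inj.1 hab.2.2⟩
    · rintro ⟨ha, hb⟩
      subst ha hb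
      exact ⟨rfl, by rw [design_uSlot₂ X u.1 u.2 h h₂]⟩
  · -- not an interaction pair: the coordinate `(0,0)` is never an arc
    dsimp only at hv hd
    have hedge : qgEdge r (u, (v1, v2)) = false := by
      rw [Bool.eq_false_iff]
      intro he
      simp only [qgEdge, Bool.and_eq_true, beq_iff_eq, Bool.or_eq_true] at he
      omega
    simp only [hedge, Bool.false_eq_true, false_and, iff_false, not_and]
    exact fun _ => design_ne X _

/-- **INPUT (A) of the line `queue_grid_face` — `QueueGridFaceProjection`, general `r`** (the body of the line's
`def QueueGridFaceProjection : Prop` verbatim, with this file's verbatim copies of `newt`, `QGV`, `queueGridPP`): for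
`r ≥ 1` and `n ≥ (r+1)(2r+1)`, an affine section of `NFP(2n) = Newt(NN_n)` (the coordinate face of the layout-B allowed
arcs) maps by a coordinate restriction EXACTLY onto the pair-pattern polytope `PP_r` of the `r × r` queue grid.
Rigidity of the single-window queue-grid word face: the nest-free perfect matchings on the allowed arcs are exactly the
`2^{r²}` designs.  (K1 itself needs input (B) as well; VP ≠ VNP is not proved.) -/
theorem queueGridFaceProjection :
    ∀ r n : ℕ, 1 ≤ r → (r + 1) * (2 * r + 1) ≤ n →
      ∃ (k : ℕ) (cv : Fin k → (Fin (2 * n) × Fin (2 * n) → ℝ)) (δ : Fin k → ℝ)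
        (f : (QGV r × QGV r) × Bool × Bool → Fin (2 * n) × Fin (2 * n)),
        (fun x : (Fin (2 * n) × Fin (2 * n)) → ℝ => x ∘ f) ''
            (newt (nestFreeMatchingPoly n ℝ≥0) ∩ {x | ∀ t, cv t ⬝ᵥ x = δ t}) = queueGridPP r := by
  intro r n _ hn
  obtain ⟨d, rfl⟩ := Nat.exists_eq_add_of_le hn
  obtain ⟨k, cv, δ, h⟩ := face_projection_of_gadget_prop (n := half r d) (design d)
    (allowed r d : Set (Fin (2 * half r d) × Fin (2 * half r d))) (coordMap r d)
    (fun X q => qgEdge r q.1 = true ∧ X q.1.1 = q.2.1 ∧ X q.1.2 = q.2.2)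
    (fun X => design_mem_nestFreeMatchings X)
    (fun X i hi => Finset.mem_coe.2 (design_mem_allowed X i hi))
    (fun M hM hE => exists_design_eq M hM fun p hp => Finset.mem_coe.1 (hE p hp))
    (fun X q => coordMap_arc_iff X q)
  exact ⟨k, cv, δ, coordMap r d, h⟩

end Summit.ValiantsHypothesis.ValiantsHypothesis.Theorems.FifoMatching.NFPolytopeQuasiPolyXC.QueueGridFace

end
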